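import Summits.QuantumFields.YangMills.Theorems.BalabanUVNodesN08HaarCompatibilityGuardCrossingJointLaw
import Literature.MathematicalPhysics.QuantumFieldTheory.Balaban1983to89.B11GaugeGlue

/-!
# BalabanUVNodes ∕ N08 — THE JOINT GUARD-ADMITTING BOUND: the backgrounds at which a SET `S` of coarse bonds can all be brought into the small-field guard by
# their private coordinates have `dU`-probability `≤ (Haar{dist1 < 2δ}^{L^{d−1}−1} ∕ Haar{dist1 < δ})^{|S|}` — the per-level constant `s` of the one-step bound

WIDTH SEAT `pub-ymgap-dag-n08-w3` g4, `W-SEAT-START-LIST.md` v10 §0 (iii); item-3 lineage part 19, 2026-08-28.  DAG node N08 = [Balaban1985UV3] Thm 1 p. 257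
(compact) + Thm 2 p. 272; key item K1⁷ `StabilityBAtRecordR13SepCoPH` (stmt-QuantumFields-20542), `--supports … --as helper`.  COUNT-NEUTRAL.

THE POINT.  In the mixture normal form (part 13) the one-variable fibre law of the typed (0.4) averaging at `c` is an exact Haar translate UNLESS the
background `U` is GUARD-ADMITTING at `c`: `∃ g, Small ℰ (U[β(c) ↦ g]) c`.  Part 16 (`…GuardMixtureDensity`) turns a per-fibre density constant `K` into
`density(Ū_*(dU)) ≤ E_U Π_c (1 + (K−1)·1[ga_c])`, so the per-level constant is governed by the JOINT probabilities `dU{∀ c ∈ S, ga_c}`.  This file bounds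
them by a PRODUCT, from part 18's joint law of the crossing loops (`…GuardCrossingJointLaw`) and pub-balaban's resampling lemma:
* §1 (pointwise, any group): `loopHol_extend_eq_loopHol_update` (the loops of `c` see the resampled field `U[β ↦ g]` only through `g_c`: FACT (A));
  `dist1_loopHol_update_le` (moving the private coordinate from `g′` to `g` moves every non-central loop variable of `c` by at most `dist1(g′g⁻¹)` — part 6's
  conjugation normal form `pre⁻¹·W·pre = A(U)·U(β(c))⁻¹`); hence ★ `haar_ball_le_haar_crossSmall_of_exists`: if SOME `g′` makes the crossing loops of `c`
  `ρ`-small, then a Haar-`δ′`-BALL of private coordinates makes them `(ρ + δ′)`-small — guard-admitting backgrounds are caught by a MEASURABLE super-event of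
  controlled size, `GA♯_c = {U | Haar{dist1 < δ′} ≤ Haar{g | crossing loops of c at U[β(c) ↦ g] are (ρ+δ′)-small}}` (`setOf_exists_small_subset`).
* §2 ★★ `lintegral_prod_haar_crossSmall_eq` — RESAMPLING: `∫ Π_{c∈S} Haar{g | crossing loops of c (ρ′)-small at U[β(c) ↦ g]} dU(U) = dU{∀ c ∈ S, crossing loops of c
  (ρ′)-small}` (pub-balaban's `measurePreserving_resample` + Fubini + §1), which part 18 bounds by `Haar{dist1 < ρ′}^{|S|·(L^{d−1}−1)}`; hence ★★★
  `measure_forall_guardSharp_le` and **`measure_forall_guardAdmitting_le`: `Haar{dist1 < δ′}^{|S|} · dU{U | ∀ c ∈ S, ∃ g, Small ℰ (U[β(c) ↦ g]) c} ≤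
  Haar{dist1 < δ + δ′}^{|S|·(L^{d−1}−1)}`** for every finset `S` of coarse bonds (every group, every small-loop average `ℰ` of radius `δ`, standing range; at the
  [B10] slot on `SU(N)`: `measure_forall_guardAdmitting_avOfPrint_le`).  Reading with `δ′ = δ`: `dU{∀ c ∈ S, ga_c} ≤ s^{|S|}`, `s = h(2δ)^{L^{d−1}−1}∕h(δ)`.

HONEST FRAMING.  [folklore] measure theory about the printed loop words of (0.4); nothing of Bałaban's asserted; no density bound for print's averaging is claimed
(the per-fibre constant `K` is n08-w6's ∕ the engine's); E6′ NOT decided; `hmass` NOT supplied; count-neutral; N08 NOT discharged; counts unmoved (typed 28∕28 ·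
discharged 5∕27); one finite 𝕋⁴ programme at fixed ε — R4 closes the CONDITIONAL rung `BalabanLadder.UV` only; the Yang–Mills mass gap (Clay) is NOT proved;
nothing continuum ∕ OS.  0 `sorry`, 0 `def`, standard axioms.
-/

noncomputable section

open MeasureTheory Function
open scoped ENNReal

namespace Summit.QuantumFields.YangMills.BalabanUVNodes.N08HaarCompatibilityGuardAdmitting

open Literature.MathematicalPhysics.QuantumFieldTheory.Balaban1983to89
open Literature.MathematicalPhysics.QuantumFieldTheory.Balaban1983to89.T4Continuum
open Literature.MathematicalPhysics.QuantumFieldTheory.Balaban1983to89.T4ReflectionCone (holAt_congr)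
open Literature.MathematicalPhysics.QuantumFieldTheory.Balaban1983to89.BlockAveraging (Idx off loopHol Small measurable_loopHol)
open Literature.MathematicalPhysics.QuantumFieldTheory.Balaban1983to89.BlockAveragingHaarAC
  (IsCentral centralBond centralBond_injective eq_of_mem_walk_loopWord_of_eq_centralBond pre)
open Literature.MathematicalPhysics.QuantumFieldTheory.Balaban1983to89.T4TriangularPushforward (measurable_resample measurePreserving_resample)
open Summit.QuantumFields.YangMills.BalabanUVNodes.N08HaarCompatibilityGuard (conj_loopHol_update)
open Summit.QuantumFields.YangMills.BalabanUVNodes.N08HaarCompatibilityGuardCrossingLaw (card_offsets)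
open Summit.QuantumFields.YangMills.BalabanUVNodes.N08HaarCompatibilityGuardCrossingJointLaw (measure_forall_crossLoops_lt_le_pow)

variable {P : Params} {j : ℕ} {G : Type*} [GaugeGroup G]

/-! ## §1 Pointwise: the loops of `c` under resampling; moving the private coordinate -/

/-- **THE LOOPS OF `c` SEE THE RESAMPLED FIELD ONLY THROUGH `g_c`**: `U(loops_c)(U[β ↦ g]) = U(loops_c)(U[β(c) ↦ g_c])` (FACT (A): `β(c′)`, `c′ ≠ c`, lies on no
loop of `c`). [cite: Balaban1987RG1, (0.4) p.253 (bookkeeping)] -/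
theorem loopHol_extend_eq_loopHol_update (hj : j + 1 ≤ P.m + P.K) (U : GaugeField P j G) (g : PBond P (j + 1) → G) (c : PBond P (j + 1)) :
    loopHol (Function.extend centralBond g U) c = loopHol (update U (centralBond c) (g c)) c := by
  funext i
  unfold loopHol
  refine holAt_congr fun s hs => ?_
  by_cases hb : ∃ c', centralBond c' = s.bond
  · obtain ⟨c', hc'⟩ := hb
    have hcc : c' = c := eq_of_mem_walk_loopWord_of_eq_centralBond hj c c' i hs hc'.symm
    subst hcc
    rw [← hc', (centralBond_injective hj).extend_apply, update_self]
  · rw [extend_apply' _ _ _ hb, update_of_ne fun h => hb ⟨c, h.symm⟩]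

/-- **MOVING THE PRIVATE COORDINATE MOVES EACH NON-CENTRAL LOOP VARIABLE BY AT MOST THE MOVE**: `dist1 W_i(U[β(c) ↦ g]) ≤ dist1 W_i(U[β(c) ↦ g′]) + dist1(g′g⁻¹)`
— part 6's normal form `pre⁻¹·W_i·pre = A_i(U)·U(β(c))⁻¹` with `A_i` free of `U(β(c))` (standing range). [cite: Balaban1987RG1, (0.4) p.253 (bookkeeping)] -/
theorem dist1_loopHol_update_le (hj : j + 1 ≤ P.m + P.K) (U : GaugeField P j G) (c : PBond P (j + 1)) {i : Idx P} (hi : ¬ IsCentral c i) (g g' : G) :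
    dist1 (loopHol (update U (centralBond c) g) c i) ≤ dist1 (loopHol (update U (centralBond c) g') c i) + dist1 (g' * g⁻¹) := by
  set V : GaugeField P j G := update U (centralBond c) g' with hV
  have hVβ : V (centralBond c) = g' := by rw [hV, update_self]
  have hUg : update U (centralBond c) g = update V (centralBond c) ((g * g'⁻¹) * V (centralBond c)) := by
    rw [hVβ, inv_mul_cancel_right, hV, update_idem]
  have key := conj_loopHol_update hj V c hi (g * g'⁻¹)
  rw [← hUg] at key
  -- `dist1` is conjugation invariant: read both sides of `key` through `dist1`
  have h1 : dist1 (loopHol (update U (centralBond c) g) c i) =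
      dist1 ((pre (update U (centralBond c) g) c)⁻¹ * loopHol (update U (centralBond c) g) c i * pre (update U (centralBond c) g) c) :=
    (B11GaugeGlue.dist1_conj_inv _ _).symm
  have h2 : dist1 ((pre V c)⁻¹ * loopHol V c i * pre V c) = dist1 (loopHol V c i) := B11GaugeGlue.dist1_conj_inv _ _
  rw [h1, key]
  calc dist1 ((pre V c)⁻¹ * loopHol V c i * pre V c * (g * g'⁻¹)⁻¹)
      ≤ dist1 ((pre V c)⁻¹ * loopHol V c i * pre V c) + dist1 (g * g'⁻¹)⁻¹ := GaugeGroup.dist1_mul_le _ _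
    _ = dist1 (loopHol V c i) + dist1 (g' * g⁻¹) := by rw [h2, mul_inv_rev, inv_inv]

/-- The crossing index `(r, 1, 1)` of a non-central transverse offset is non-central (plumbing). [folklore] -/
theorem not_isCentral_val (c : PBond P (j + 1)) (r : {r : Fin P.d → Fin P.L // off r c.dir = 0 ∧ ¬ IsCentral c (r, 1, 1)}) :
    ¬ IsCentral c (r.1, 1, 1) := r.2.2

/-- ★ **A BALL OF PRIVATE COORDINATES AROUND A SMALL ONE KEEPS THE CROSSING LOOPS SMALL**: if at `U[β(c) ↦ g′]` every crossing loop of `c` is `ρ`-small, then at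
`U[β(c) ↦ g]` with `dist1(g′g⁻¹) < δ′` every crossing loop is `(ρ + δ′)`-small. [cite: Balaban1987RG1, (0.4) p.253 (bookkeeping)] -/
theorem forall_crossSmall_update_of_near (hj : j + 1 ≤ P.m + P.K) (U : GaugeField P j G) (c : PBond P (j + 1)) {ρ δ' : ℝ} {g g' : G}
    (hg' : ∀ r : {r : Fin P.d → Fin P.L // off r c.dir = 0 ∧ ¬ IsCentral c (r, 1, 1)}, dist1 (loopHol (update U (centralBond c) g') c (r.1, 1, 1)) < ρ)
    (hgg : dist1 (g' * g⁻¹) < δ') (r : {r : Fin P.d → Fin P.L // off r c.dir = 0 ∧ ¬ IsCentral c (r, 1, 1)}) :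
    dist1 (loopHol (update U (centralBond c) g) c (r.1, 1, 1)) < ρ + δ' :=
  (dist1_loopHol_update_le hj U c r.2.2 g g').trans_lt (add_lt_add (hg' r) hgg)

variable [MeasurableSpace G] [RegularGaugeGroup G]

/-- The event «the crossing loops of `c` are `ρ`-small at `U[β(c) ↦ g]`» is jointly measurable in `(U, g)` (plumbing). [folklore] -/
theorem measurableSet_crossSmall_update (c : PBond P (j + 1)) (ρ : ℝ) :
    MeasurableSet {p : GaugeField P j G × G | ∀ r : {r : Fin P.d → Fin P.L // off r c.dir = 0 ∧ ¬ IsCentral c (r, 1, 1)},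
      dist1 (loopHol (update p.1 (centralBond c) p.2) c (r.1, 1, 1)) < ρ} := by
  have hu : Measurable fun p : GaugeField P j G × G => update p.1 (centralBond c) p.2 := measurable_update'
  rw [show {p : GaugeField P j G × G | ∀ r : {r : Fin P.d → Fin P.L // off r c.dir = 0 ∧ ¬ IsCentral c (r, 1, 1)},
      dist1 (loopHol (update p.1 (centralBond c) p.2) c (r.1, 1, 1)) < ρ} =
      ⋂ r : {r : Fin P.d → Fin P.L // off r c.dir = 0 ∧ ¬ IsCentral c (r, 1, 1)},
        {p | dist1 (loopHol (update p.1 (centralBond c) p.2) c (r.1, 1, 1)) < ρ} by ext p; simp]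
  exact MeasurableSet.iInter fun r => measurableSet_lt
    (RegularGaugeGroup.measurable_dist1.comp ((measurable_pi_apply _).comp ((measurable_loopHol c).comp hu))) measurable_const

/-- The event «the crossing loops of `c` are `ρ`-small at `V`» is measurable in `V` (plumbing). [folklore] -/
theorem measurableSet_crossSmall (c : PBond P (j + 1)) (ρ : ℝ) :
    MeasurableSet {V : GaugeField P j G | ∀ r : {r : Fin P.d → Fin P.L // off r c.dir = 0 ∧ ¬ IsCentral c (r, 1, 1)},
      dist1 (loopHol V c (r.1, 1, 1)) < ρ} := by
  rw [show {V : GaugeField P j G | ∀ r : {r : Fin P.d → Fin P.L // off r c.dir = 0 ∧ ¬ IsCentral c (r, 1, 1)}, dist1 (loopHol V c (r.1, 1, 1)) < ρ} =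
      ⋂ r : {r : Fin P.d → Fin P.L // off r c.dir = 0 ∧ ¬ IsCentral c (r, 1, 1)}, {V | dist1 (loopHol V c (r.1, 1, 1)) < ρ} by ext V; simp]
  exact MeasurableSet.iInter fun r => measurableSet_lt
    (RegularGaugeGroup.measurable_dist1.comp ((measurable_pi_apply _).comp (measurable_loopHol c))) measurable_const

variable [HaarData G]

/-- The background-dependent Haar probability that a fresh private coordinate makes the crossing loops of `c` `ρ`-small is measurable in the background. [folklore] -/
theorem measurable_haar_crossSmall_update (c : PBond P (j + 1)) (ρ : ℝ) :
    Measurable fun U : GaugeField P j G => (HaarData.haar : Measure G)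
      {g : G | ∀ r : {r : Fin P.d → Fin P.L // off r c.dir = 0 ∧ ¬ IsCentral c (r, 1, 1)}, dist1 (loopHol (update U (centralBond c) g) c (r.1, 1, 1)) < ρ} := by
  haveI := HaarData.isProb (G := G)
  exact measurable_measure_prodMk_left (measurableSet_crossSmall_update c ρ)

/-- ★ **GUARD-ADMITTING ⇒ A HAAR BALL OF GOOD PRIVATE COORDINATES**: if SOME `g′` makes every crossing loop of `c` `ρ`-small at `U[β(c) ↦ g′]`, then
`Haar{dist1 < δ′} ≤ Haar{g | every crossing loop of c is (ρ+δ′)-small at U[β(c) ↦ g]}` (right-invariance of Haar). [cite: Balaban1987RG1, (0.4) p.253 (bookkeeping)] -/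
theorem haar_ball_le_haar_crossSmall_of_exists (hj : j + 1 ≤ P.m + P.K) (U : GaugeField P j G) (c : PBond P (j + 1)) {ρ δ' : ℝ}
    (h : ∃ g' : G, ∀ r : {r : Fin P.d → Fin P.L // off r c.dir = 0 ∧ ¬ IsCentral c (r, 1, 1)}, dist1 (loopHol (update U (centralBond c) g') c (r.1, 1, 1)) < ρ) :
    (HaarData.haar : Measure G) {g : G | dist1 g < δ'} ≤ (HaarData.haar : Measure G)
      {g : G | ∀ r : {r : Fin P.d → Fin P.L // off r c.dir = 0 ∧ ¬ IsCentral c (r, 1, 1)},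
        dist1 (loopHol (update U (centralBond c) g) c (r.1, 1, 1)) < ρ + δ'} := by
  obtain ⟨g', hg'⟩ := h
  have hball : MeasurableSet {g : G | dist1 g < δ'} := measurableSet_lt RegularGaugeGroup.measurable_dist1 measurable_const
  -- the right translate `{g | dist1 (g g′⁻¹) < δ′}` of the ball has the same Haar measure and is contained in the event
  calc (HaarData.haar : Measure G) {g : G | dist1 g < δ'}
      = ((HaarData.haar : Measure G).map fun h => h * g'⁻¹) {g : G | dist1 g < δ'} := by rw [HaarData.map_mul_right]
    _ = (HaarData.haar : Measure G) ((fun h => h * g'⁻¹) ⁻¹' {g : G | dist1 g < δ'}) := Measure.map_apply (measurable_mul_const _) hball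
    _ ≤ _ := by
        refine measure_mono fun g (hg : dist1 (g * g'⁻¹) < δ') r => ?_
        have hgg : dist1 (g' * g⁻¹) < δ' := by rwa [← GaugeGroup.dist1_inv, mul_inv_rev, inv_inv]
        exact forall_crossSmall_update_of_near hj U c hg' hgg r

/-- **THE GUARD-ADMITTING BACKGROUNDS SIT INSIDE A MEASURABLE SUPER-EVENT**: `{U | ∃ g, Small ℰ (U[β(c) ↦ g]) c} ⊆ GA♯_c := {U | Haar{dist1 < δ′} ≤ Haar{g | crossing
loops of c (δ + δ′)-small at U[β(c) ↦ g]}}`. [cite: Balaban1987RG1, (0.4) p.253 (the guard of the typed log; bookkeeping)] -/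
theorem setOf_exists_small_subset (ℰ : LoopAverage G) (hj : j + 1 ≤ P.m + P.K) (c : PBond P (j + 1)) (δ' : ℝ) :
    {U : GaugeField P j G | ∃ g : G, Small ℰ (update U (centralBond c) g) c} ⊆
      {U : GaugeField P j G | (HaarData.haar : Measure G) {g : G | dist1 g < δ'} ≤ (HaarData.haar : Measure G)
        {g : G | ∀ r : {r : Fin P.d → Fin P.L // off r c.dir = 0 ∧ ¬ IsCentral c (r, 1, 1)},
          dist1 (loopHol (update U (centralBond c) g) c (r.1, 1, 1)) < ℰ.δ + δ'}} := by
  rintro U ⟨g', hg'⟩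
  exact haar_ball_le_haar_crossSmall_of_exists hj U c ⟨g', fun r => hg' _⟩

/-! ## §2 The joint bound by resampling -/

/-- ★★ **RESAMPLING IDENTITY**: `∫ Π_{c∈S} Haar{g | crossing loops of c ρ-small at U[β(c) ↦ g]} dU(U) = dU{U | ∀ c ∈ S, crossing loops of c ρ-small at U}` — replacing
every private coordinate by a fresh independent Haar variable preserves `dU` (pub-balaban's `measurePreserving_resample`), the loops of `c` see only `g_c` (§1),
Fubini and the box formula. [cite: Balaban1987RG1, (0.4) p.253 (bookkeeping)] -/
theorem lintegral_prod_haar_crossSmall_eq (hj : j + 1 ≤ P.m + P.K) (ρ : ℝ) (S : Finset (PBond P (j + 1))) :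
    ∫⁻ U, ∏ c ∈ S, (HaarData.haar : Measure G)
        {g : G | ∀ r : {r : Fin P.d → Fin P.L // off r c.dir = 0 ∧ ¬ IsCentral c (r, 1, 1)}, dist1 (loopHol (update U (centralBond c) g) c (r.1, 1, 1)) < ρ}
        ∂(fieldMeasure P j G) =
      fieldMeasure P j G {U : GaugeField P j G | ∀ c ∈ S, ∀ r : {r : Fin P.d → Fin P.L // off r c.dir = 0 ∧ ¬ IsCentral c (r, 1, 1)},
        dist1 (loopHol U c (r.1, 1, 1)) < ρ} := by
  classical
  haveI := HaarData.isProb (G := G)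
  have hres := measurePreserving_resample (ι := PBond P j) (κ := PBond P (j + 1)) (HaarData.haar : Measure G) (centralBond_injective hj)
  have hE : MeasurableSet {U : GaugeField P j G | ∀ c ∈ S, ∀ r : {r : Fin P.d → Fin P.L // off r c.dir = 0 ∧ ¬ IsCentral c (r, 1, 1)},
      dist1 (loopHol U c (r.1, 1, 1)) < ρ} := by
    rw [show {U : GaugeField P j G | ∀ c ∈ S, ∀ r : {r : Fin P.d → Fin P.L // off r c.dir = 0 ∧ ¬ IsCentral c (r, 1, 1)}, dist1 (loopHol U c (r.1, 1, 1)) < ρ} =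
        ⋂ c ∈ S, {U : GaugeField P j G | ∀ r : {r : Fin P.d → Fin P.L // off r c.dir = 0 ∧ ¬ IsCentral c (r, 1, 1)}, dist1 (loopHol U c (r.1, 1, 1)) < ρ} by
      ext U; simp]
    exact S.measurableSet_biInter fun c _ => measurableSet_crossSmall c ρ
  -- `dU(E) = (dU ⊗ Haar^κ)(res⁻¹ E)` and Fubini
  have h1 : fieldMeasure P j G {U : GaugeField P j G | ∀ c ∈ S, ∀ r : {r : Fin P.d → Fin P.L // off r c.dir = 0 ∧ ¬ IsCentral c (r, 1, 1)},
        dist1 (loopHol U c (r.1, 1, 1)) < ρ} =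
      ((fieldMeasure P j G).prod (Measure.pi fun _ : PBond P (j + 1) => (HaarData.haar : Measure G)))
        ((fun p : GaugeField P j G × (PBond P (j + 1) → G) => Function.extend centralBond p.2 p.1) ⁻¹'
          {U : GaugeField P j G | ∀ c ∈ S, ∀ r : {r : Fin P.d → Fin P.L // off r c.dir = 0 ∧ ¬ IsCentral c (r, 1, 1)},
            dist1 (loopHol U c (r.1, 1, 1)) < ρ}) := (hres.measure_preimage hE.nullMeasurableSet).symm
  have hT : MeasurableSet ((fun p : GaugeField P j G × (PBond P (j + 1) → G) => Function.extend centralBond p.2 p.1) ⁻¹'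
      {U : GaugeField P j G | ∀ c ∈ S, ∀ r : {r : Fin P.d → Fin P.L // off r c.dir = 0 ∧ ¬ IsCentral c (r, 1, 1)},
        dist1 (loopHol U c (r.1, 1, 1)) < ρ}) := hres.measurable hE
  rw [h1]
  refine Eq.trans ?_ (Measure.prod_apply hT).symm
  refine lintegral_congr fun U => ?_
  -- the `U`-section of `res⁻¹ E` is a box in the fresh coordinates
  have hsec : Prod.mk U ⁻¹' ((fun p : GaugeField P j G × (PBond P (j + 1) → G) => Function.extend centralBond p.2 p.1) ⁻¹'
      {U : GaugeField P j G | ∀ c ∈ S, ∀ r : {r : Fin P.d → Fin P.L // off r c.dir = 0 ∧ ¬ IsCentral c (r, 1, 1)}, dist1 (loopHol U c (r.1, 1, 1)) < ρ}) =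
      Set.pi Set.univ fun c => if c ∈ S then
        {g : G | ∀ r : {r : Fin P.d → Fin P.L // off r c.dir = 0 ∧ ¬ IsCentral c (r, 1, 1)}, dist1 (loopHol (update U (centralBond c) g) c (r.1, 1, 1)) < ρ}
        else Set.univ := by
    ext g
    simp only [Set.mem_preimage, Set.mem_univ_pi]
    constructor
    · intro h c
      by_cases hc : c ∈ S
      · rw [if_pos hc]
        intro r
        have := h c hc r
        rwa [loopHol_extend_eq_loopHol_update hj U g c] at this
      · rw [if_neg hc]; exact Set.mem_univ _
    · intro h c hc r
      have := h c
      rw [if_pos hc] at this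
      rw [loopHol_extend_eq_loopHol_update hj U g c]
      exact this r
  rw [hsec, Measure.pi_pi]
  rw [← Finset.prod_filter_mul_prod_filter_not Finset.univ (fun c => c ∈ S), Finset.filter_mem_eq_inter, Finset.univ_inter]
  have h2 : ∏ c ∈ Finset.univ.filter (fun c : PBond P (j + 1) => ¬ c ∈ S), (HaarData.haar : Measure G)
      (if c ∈ S then {g : G | ∀ r : {r : Fin P.d → Fin P.L // off r c.dir = 0 ∧ ¬ IsCentral c (r, 1, 1)},
        dist1 (loopHol (update U (centralBond c) g) c (r.1, 1, 1)) < ρ} else Set.univ) = 1 :=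
    Finset.prod_eq_one fun c hc => by rw [Finset.mem_filter] at hc; rw [if_neg hc.2, measure_univ]
  rw [h2, mul_one]
  exact (Finset.prod_congr rfl fun c hc => by rw [if_pos hc]).symm

/-- ★★★ **THE JOINT BOUND FOR THE MEASURABLE SUPER-EVENTS**: `Haar{dist1 < δ′}^{|S|} · dU{∀ c ∈ S, U ∈ GA♯_c} ≤ Haar{dist1 < ρ + δ′}^{|S|·(L^{d−1}−1)}` — Markov on the
product of the background-dependent Haar probabilities, the resampling identity, and part 18's joint law of the crossing loops. [cite: Balaban1987RG1, (0.4) p.253 (bookkeeping)] -/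
theorem measure_forall_guardSharp_le (hj : j + 1 ≤ P.m + P.K) (ρ δ' : ℝ) (S : Finset (PBond P (j + 1))) :
    (HaarData.haar : Measure G) {g : G | dist1 g < δ'} ^ S.card *
        fieldMeasure P j G {U : GaugeField P j G | ∀ c ∈ S, (HaarData.haar : Measure G) {g : G | dist1 g < δ'} ≤ (HaarData.haar : Measure G)
          {g : G | ∀ r : {r : Fin P.d → Fin P.L // off r c.dir = 0 ∧ ¬ IsCentral c (r, 1, 1)},
            dist1 (loopHol (update U (centralBond c) g) c (r.1, 1, 1)) < ρ + δ'}} ≤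
      (HaarData.haar : Measure G) {g : G | dist1 g < ρ + δ'} ^ (S.card * (P.L ^ (P.d - 1) - 1)) := by
  set F : PBond P (j + 1) → GaugeField P j G → ℝ≥0∞ := fun c U => (HaarData.haar : Measure G)
    {g : G | ∀ r : {r : Fin P.d → Fin P.L // off r c.dir = 0 ∧ ¬ IsCentral c (r, 1, 1)},
      dist1 (loopHol (update U (centralBond c) g) c (r.1, 1, 1)) < ρ + δ'} with hF
  have hFm : ∀ c, Measurable (F c) := fun c => measurable_haar_crossSmall_update c (ρ + δ')
  set GS : Set (GaugeField P j G) := {U | ∀ c ∈ S, (HaarData.haar : Measure G) {g : G | dist1 g < δ'} ≤ F c U} with hGS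
  calc (HaarData.haar : Measure G) {g : G | dist1 g < δ'} ^ S.card * fieldMeasure P j G GS
      = ∫⁻ _ in GS, (HaarData.haar : Measure G) {g : G | dist1 g < δ'} ^ S.card ∂(fieldMeasure P j G) :=
        (setLIntegral_const (μ := fieldMeasure P j G) GS _).symm
    _ ≤ ∫⁻ U in GS, ∏ c ∈ S, F c U ∂(fieldMeasure P j G) := by
        refine setLIntegral_mono (Finset.measurable_prod _ fun c _ => hFm c) fun U hU => ?_
        rw [← Finset.prod_const]
        exact Finset.prod_le_prod' fun c hc => hU c hc
    _ ≤ ∫⁻ U, ∏ c ∈ S, F c U ∂(fieldMeasure P j G) := setLIntegral_le_lintegral GS _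
    _ = fieldMeasure P j G {U : GaugeField P j G | ∀ c ∈ S, ∀ r : {r : Fin P.d → Fin P.L // off r c.dir = 0 ∧ ¬ IsCentral c (r, 1, 1)},
        dist1 (loopHol U c (r.1, 1, 1)) < ρ + δ'} := lintegral_prod_haar_crossSmall_eq hj (ρ + δ') S
    _ ≤ _ := measure_forall_crossLoops_lt_le_pow hj (ρ + δ') S

/-- ★★★ **THE JOINT GUARD-ADMITTING BOUND**: for every finset `S` of coarse bonds and every `δ′`,
`Haar{dist1 < δ′}^{|S|} · dU{U | ∀ c ∈ S, ∃ g, Small ℰ (U[β(c) ↦ g]) c} ≤ Haar{dist1 < δ + δ′}^{|S|·(L^{d−1}−1)}` (`δ = ℰ.δ`): the backgrounds at which all bonds of `S`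
can be brought into the guard are as rare as `(Haar{dist1 < δ+δ′}^{L^{d−1}−1} ∕ Haar{dist1 < δ′})^{|S|}` — the per-level constant `s` of the one-step transport bound, at `δ′ = δ`.
[cite: Balaban1987RG1, (0.4) p.253 (the guard of the typed log; bookkeeping)] -/
theorem measure_forall_guardAdmitting_le (ℰ : LoopAverage G) (hj : j + 1 ≤ P.m + P.K) (δ' : ℝ) (S : Finset (PBond P (j + 1))) :
    (HaarData.haar : Measure G) {g : G | dist1 g < δ'} ^ S.card *
        fieldMeasure P j G {U : GaugeField P j G | ∀ c ∈ S, ∃ g : G, Small ℰ (update U (centralBond c) g) c} ≤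
      (HaarData.haar : Measure G) {g : G | dist1 g < ℰ.δ + δ'} ^ (S.card * (P.L ^ (P.d - 1) - 1)) := by
  refine le_trans (mul_le_mul' le_rfl (measure_mono (μ := fieldMeasure P j G) ?_)) (measure_forall_guardSharp_le hj ℰ.δ δ' S)
  exact fun U (hU : ∀ c ∈ S, ∃ g : G, Small ℰ (update U (centralBond c) g) c) c hc => setOf_exists_small_subset ℰ hj c δ' (hU c hc)

/-! ## §3 At the [B10] slot's averaging on `SU(N)` -/

section Slot

open Literature.MathematicalPhysics.QuantumFieldTheory.Balaban1985CMP102.Setting (Scales)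
open Literature.MathematicalPhysics.QuantumFieldTheory.Balaban1983to89.ExpMeanLog (expMeanLogSU expMeanLogSU_δ)
open Literature.MathematicalPhysics.QuantumFieldTheory.Balaban1983to89.Node00 (SU)

variable (N : ℕ) [NeZero N] {L : ℕ}

/-- ★★★ **AT THE SLOT** (`d = 3`, the printed exp-mean-log guard of radius `δ_N = min(1∕3, π∕N)` on `SU(N)`, every `N`, standing range): for every finset `S` of coarse bonds,
`Haar{‖W−1‖ < δ_N}^{|S|} · dU{U | ∀ c ∈ S, ∃ g, Small (U[β(c) ↦ g]) c} ≤ Haar{‖W−1‖ < 2δ_N}^{|S|·(L²−1)}`. [cite: Balaban1985UV3, (2) p.256; Balaban1987RG1, (0.4) p.253 (bookkeeping)] -/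
theorem measure_forall_guardAdmitting_avOfPrint_le (S₀ : Scales L) {j : ℕ} (hj : j + 1 ≤ S₀.P.m + S₀.P.K) (S : Finset (PBond S₀.P (j + 1))) :
    (HaarData.haar : Measure (SU N)) {g : SU N | dist1 g < min (1 / 3) (Real.pi / N)} ^ S.card *
        fieldMeasure S₀.P j (SU N) {U : GaugeField S₀.P j (SU N) | ∀ c ∈ S, ∃ g : SU N,
          Small (expMeanLogSU : LoopAverage (SU N)) (update U (centralBond c) g) c} ≤
      (HaarData.haar : Measure (SU N)) {g : SU N | dist1 g < min (1 / 3) (Real.pi / N) + min (1 / 3) (Real.pi / N)} ^ (S.card * (S₀.P.L ^ (S₀.P.d - 1) - 1)) := by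
  have h := measure_forall_guardAdmitting_le (expMeanLogSU : LoopAverage (SU N)) hj (min (1 / 3) (Real.pi / N)) S
  rwa [expMeanLogSU_δ, Fintype.card_fin] at h

end Slot

end Summit.QuantumFields.YangMills.BalabanUVNodes.N08HaarCompatibilityGuardAdmitting
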